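import Literature.Geometry.Kaehler.RiemannSurfaceGenusOnePeriods
import HarnessLib

/-!
# The holomorphic map `T → ℂ/G` of a compact Riemann surface of genus one onto the torus of its
# periods (Farkas–Kra III.6.4)

Layer `Literature/Geometry/Kaehler`, sequel of `RiemannSurfaceGenusOnePeriods` (the periods
`P n = F (Φ₀ n) − F 0` of a development `F` of a nowhere-vanishing holomorphic `1`-form `ω` along
the universal covering `q = e₀⁻¹ ∘ cover Φ₀ : ℂ → T` of a compact Riemann surface `T` given with a
homeomorphism `e₀ : T ≃ₜ ℂ/Φ₀(ℤ²)`; the period frame `Φ` with `Φ(ℤ²) = G` the period lattice).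
H. M. Farkas, I. Kra, *Riemann Surfaces*, GTM 71 (1992), III.6.4 (book p. 93), as printed:

> […] and `φ` is a well-defined holomorphic map of `M` onto the torus `ℂ/G`. […] Since `φ₁` has
> no zeros, `φ` is a local homeomorphism.

Given a frame `Φ : ℝ² ≃L[ℝ] ℂ` of the period lattice (`latticeVec Φ n = P n`,
`IsDevelopment.exists_frame`), the development `F : ℂ → ℂ` DESCENDS along `q` to the tree's complex
torus `ComplexTorus Φ = ℂ/Φ(ℤ²)`:

* `IsDevelopment.cover_apply_eq_of_eq` — `cover Φ ∘ F` is constant on the fibres of `q`;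
* `IsDevelopment.exists_descent` — **the map `φ : T → ℂ/G`**: there is `g : T → ComplexTorus Φ`
  with `g ∘ q = cover Φ ∘ F`;
* for any such `g`: `descent_continuous`, **`descent_mdifferentiable`** («a well-defined holomorphic
  map»), `descent_eventuallyEq` (near `q z₀`, `g = cover Φ ∘ G` with `G` an injective local
  primitive) and **`descent_exists_injOn`** («since `φ₁` has no zeros, `φ` is a local
  homeomorphism»: `g` is injective on a neighbourhood of every point).

Everything is proved; no definitions, no named facts.

## References

* H. M. Farkas, I. Kra, *Riemann Surfaces*, 2nd ed., GTM 71, Springer (1992), III.6.4.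
  [FarkasKra1992]
-/

noncomputable section

open scoped Manifold ContDiff Topology
open Set Filter Function Complex

namespace Literature.Geometry.Kaehler

namespace RiemannSurface

namespace MeromorphicOneForm

open ComplexTorus

variable {T : Type*} [TopologicalSpace T] [ChartedSpace ℂ T]
variable {Φ₀ Φ : (Fin 2 → ℝ) ≃L[ℝ] ℂ} {e₀ : T ≃ₜ ComplexTorus Φ₀}
variable {η : MeromorphicOneForm T} {F : ℂ → ℂ} {g : T → ComplexTorus Φ}

omit [ChartedSpace ℂ T] in
/-- `q = e₀⁻¹ ∘ cover Φ₀` is an open quotient map. [cite: FarkasKra1992, III.6.4] -/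
theorem isOpenQuotientMap_symm_comp_cover (e₀ : T ≃ₜ ComplexTorus Φ₀) :
    IsOpenQuotientMap fun z : ℂ ↦ e₀.symm (cover Φ₀ z) :=
  e₀.symm.isOpenQuotientMap.comp (isOpenQuotientMap_cover (Φ := Φ₀))

/-- **`cover Φ ∘ F` is constant on the fibres of `q`** when `Φ` frames the period lattice: the
values of the development at two lifts of the same point of `T` differ by a period, i.e. by a
lattice vector of `Φ(ℤ²)`. [cite: FarkasKra1992, III.6.4] -/
theorem IsDevelopment.cover_apply_eq_of_eq (hF : η.IsDevelopment (fun z ↦ e₀.symm (cover Φ₀ z)) F)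
    (hΦ : ∀ n : Fin 2 → ℤ, latticeVec Φ n = F (latticeVec Φ₀ n) - F 0) {z w : ℂ}
    (h : e₀.symm (cover Φ₀ z) = e₀.symm (cover Φ₀ w)) : cover Φ (F z) = cover Φ (F w) := by
  obtain ⟨n, rfl⟩ := (symm_cover_eq_iff e₀ z w).1 h
  rw [hF.apply_add_latticeVec, ← hΦ, cover_add_latticeVec]

/-- **The developing map descends to `φ : T → ℂ/G`** («`φ` is a well-defined … map of `M` onto the
torus `ℂ/G`»): there is `g : T → ComplexTorus Φ` with `g (q z) = cover Φ (F z)` for all `z`.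
[cite: FarkasKra1992, III.6.4] -/
theorem IsDevelopment.exists_descent (hF : η.IsDevelopment (fun z ↦ e₀.symm (cover Φ₀ z)) F)
    (hΦ : ∀ n : Fin 2 → ℤ, latticeVec Φ n = F (latticeVec Φ₀ n) - F 0) :
    ∃ g : T → ComplexTorus Φ, ∀ z, g (e₀.symm (cover Φ₀ z)) = cover Φ (F z) := by
  have hs := surjective_symm_comp_cover e₀
  refine ⟨fun t ↦ cover Φ (F (surjInv hs t)), fun z ↦ ?_⟩
  exact hF.cover_apply_eq_of_eq hΦ (surjInv_eq hs (e₀.symm (cover Φ₀ z)))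

section Descent

variable [IsManifold 𝓘(ℂ, ℂ) ω T]

/-- **`φ` is continuous**: `g ∘ q = cover Φ ∘ F` is continuous and `q` is a quotient map.
[cite: FarkasKra1992, III.6.4] -/
theorem IsDevelopment.descent_continuous (hF : η.IsDevelopment (fun z ↦ e₀.symm (cover Φ₀ z)) F)
    (hg : ∀ z, g (e₀.symm (cover Φ₀ z)) = cover Φ (F z)) : Continuous g := by
  rw [(isOpenQuotientMap_symm_comp_cover e₀).isQuotientMap.continuous_iff]
  have h : (g ∘ fun z : ℂ ↦ e₀.symm (cover Φ₀ z)) = fun z ↦ cover Φ (F z) := funext hg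
  rw [h]
  exact (continuous_cover Φ).comp (hF.continuous (continuous_symm_comp_cover e₀))

/-- **Local form of `φ`**: near `q z₀`, `g = cover Φ ∘ G` for a primitive `G` of `ω` which is
injective on a preconnected open neighbourhood of `q z₀` (for `ω` holomorphic with `ω (q z₀) ≠ 0`).
[cite: FarkasKra1992, III.6.4] -/
theorem IsDevelopment.descent_eventuallyEq (hF : η.IsDevelopment (fun z ↦ e₀.symm (cover Φ₀ z)) F)
    (hg : ∀ z, g (e₀.symm (cover Φ₀ z)) = cover Φ (F z)) (hη : η.IsHolomorphic) (z₀ : ℂ)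
    (h0 : η (e₀.symm (cover Φ₀ z₀)) ≠ 0) :
    ∃ U : Set T, IsOpen U ∧ e₀.symm (cover Φ₀ z₀) ∈ U ∧ IsPreconnected U ∧ ∃ G : T → ℂ,
      η.IsPrimitiveOn G U ∧ InjOn G U ∧ g =ᶠ[𝓝 (e₀.symm (cover Φ₀ z₀))] (cover Φ ∘ G) := by
  obtain ⟨U, hUo, hzU, hUc, G, hG, hinj, hFG⟩ :=
    hF.eventuallyEq_comp_injOn hη (continuous_symm_comp_cover e₀) h0
  refine ⟨U, hUo, hzU, hUc, G, hG, hinj, ?_⟩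
  have h1 : ∀ᶠ z in 𝓝 z₀, g (e₀.symm (cover Φ₀ z)) = cover Φ (G (e₀.symm (cover Φ₀ z))) := by
    filter_upwards [hFG] with z hz
    rw [hg, hz, comp_apply]
  have hmap := (isLocalHomeomorph_symm_comp_cover e₀).map_nhds_eq z₀
  rw [← hmap, EventuallyEq, eventually_map]
  exact h1

/-- **`φ` is holomorphic** («a well-defined holomorphic map of `M` onto the torus `ℂ/G`»): locally
`g = cover Φ ∘ G` with `cover Φ` and the primitive `G` holomorphic.
[cite: FarkasKra1992, III.6.4] -/
theorem IsDevelopment.descent_mdifferentiable (hF : η.IsDevelopment (fun z ↦ e₀.symm (cover Φ₀ z)) F)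
    (hg : ∀ z, g (e₀.symm (cover Φ₀ z)) = cover Φ (F z)) (hη : η.IsHolomorphic)
    (h0 : ∀ p, η p ≠ 0) : MDifferentiable 𝓘(ℂ, ℂ) 𝓘(ℂ, ℂ) g := by
  intro t
  obtain ⟨z₀, rfl⟩ := surjective_symm_comp_cover e₀ t
  obtain ⟨U, -, hzU, -, G, hG, -, hgG⟩ := hF.descent_eventuallyEq hg hη z₀ (h0 _)
  have hd : MDifferentiableAt 𝓘(ℂ, ℂ) 𝓘(ℂ, ℂ) (cover Φ ∘ G) (e₀.symm (cover Φ₀ z₀)) :=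
    ((mdifferentiable_cover Φ (𝕜 := ℂ)) _).comp _ (hG.mdifferentiableAt hzU)
  exact hd.congr_of_eventuallyEq hgG

/-- **`φ` is a local homeomorphism** («since `φ₁` has no zeros»): every point of `T` has an open
neighbourhood on which `g` is injective (there `g = cover Φ ∘ G` with `G` an injective primitive and
`cover Φ` a covering map). [cite: FarkasKra1992, III.6.4] -/
theorem IsDevelopment.descent_exists_injOn (hF : η.IsDevelopment (fun z ↦ e₀.symm (cover Φ₀ z)) F)
    (hg : ∀ z, g (e₀.symm (cover Φ₀ z)) = cover Φ (F z)) (hη : η.IsHolomorphic)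
    (h0 : ∀ p, η p ≠ 0) (t : T) : ∃ S : Set T, IsOpen S ∧ t ∈ S ∧ InjOn g S := by
  obtain ⟨z₀, rfl⟩ := surjective_symm_comp_cover e₀ t
  obtain ⟨U, hUo, hzU, -, G, hG, hinj, hgG⟩ := hF.descent_eventuallyEq hg hη z₀ (h0 _)
  -- `cover Φ` is injective on a neighbourhood of `G (q z₀)`
  obtain ⟨c, hcs, hc⟩ := (isCoveringMap_cover (Φ := Φ)).isLocalHomeomorph (G (e₀.symm (cover Φ₀ z₀)))
  -- the open set where `g = cover Φ ∘ G`
  obtain ⟨W, hWsub, hWo, hzW⟩ := eventually_nhds_iff.1 hgG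
  have hVo : IsOpen (U ∩ G ⁻¹' c.source) := hG.continuousOn.isOpen_inter_preimage hUo c.open_source
  refine ⟨W ∩ (U ∩ G ⁻¹' c.source), hWo.inter hVo, ⟨hzW, hzU, hcs⟩, ?_⟩
  rintro s₁ ⟨hs₁W, hs₁U, hs₁c⟩ s₂ ⟨hs₂W, hs₂U, hs₂c⟩ hs
  rw [hWsub s₁ hs₁W, hWsub s₂ hs₂W, comp_apply, comp_apply, hc] at hs
  exact hinj hs₁U hs₂U (c.injOn hs₁c hs₂c hs)

/-- **`φ` is not constant** (it is locally injective, and a point of the connected surface `T` is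
not open). [cite: FarkasKra1992, III.6.4] -/
theorem IsDevelopment.descent_exists_ne [T2Space T] [ConnectedSpace T]
    (hF : η.IsDevelopment (fun z ↦ e₀.symm (cover Φ₀ z)) F)
    (hg : ∀ z, g (e₀.symm (cover Φ₀ z)) = cover Φ (F z)) (hη : η.IsHolomorphic)
    (h0 : ∀ p, η p ≠ 0) : ∃ x y : T, g x ≠ g y := by
  set t : T := e₀.symm (cover Φ₀ 0) with ht
  obtain ⟨S, hSo, htS, hinj⟩ := hF.descent_exists_injOn hg hη h0 t
  -- a second point of `T`
  have ht' : ∃ t' : T, t' ≠ t := by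
    refine ⟨e₀.symm (fun _ ↦ ((0 - 2⁻¹ : ℝ) : AddCircle (1 : ℝ))), fun h ↦ ?_⟩
    have h1 := congrFun (e₀.symm.injective h) 0
    refine ComplexTorus.coe_sub_half_ne (0 : ℝ) ?_
    rw [h1, cover_zero]
    show (0 : Fin 2 → AddCircle (1 : ℝ)) 0 = ((0 : ℝ) : AddCircle (1 : ℝ))
    simp
  -- `{t}` is not open: otherwise it is clopen, hence all of the connected space `T`
  have hne : (S \ {t}).Nonempty := by
    by_contra hempty
    have hsub : S ⊆ {t} := fun x hx ↦ by_contra fun hxt ↦ hempty ⟨x, hx, hxt⟩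
    have hSt : S = {t} := hsub.antisymm (singleton_subset_iff.2 htS)
    have hclopen : IsClopen ({t} : Set T) := ⟨isClosed_singleton, hSt ▸ hSo⟩
    rcases isClopen_iff.1 hclopen with h | h
    · exact singleton_ne_empty t h
    · obtain ⟨t', ht'ne⟩ := ht'
      have : t' ∈ ({t} : Set T) := h ▸ mem_univ t'
      exact ht'ne this
  obtain ⟨y, hyS, hyt⟩ := hne
  exact ⟨y, t, fun h ↦ hyt (hinj hyS htS h)⟩

end Descent

end MeromorphicOneForm

end RiemannSurface

end Literature.Geometry.Kaehler
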